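import Literature.Probability.RandomPlanarGeometry.HexSAWBrickWallSlabFugacity
import HarnessLib

/-!
# Beaton 2014 Proposition 8, symmetry clause for the armchair slabs: `Ĉ_{H,n}(y,z) = Ĉ_{H,n}(z,y)`, hence `μ_H(y,1) = μ_H(1,y)`

Topic `Literature/Probability/RandomPlanarGeometry` (continues `HexSAWBrickWallSlabFugacity.lean` — the column slabs
`Slab_H = {0 ≤ x₀ ≤ H}` of the brick wall (the strips of Beaton's ROTATED = armchair honeycomb lattice), the translation
classes `HexBW.slabPairs H n` (vertical translations, `HexBW.vnorm`), the left-surface count `HexBW.leftVisits` (vertices in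
the column `x₀ = 0`; on the armchair boundary EVERY boundary vertex carries a dangling bond, so no parity condition arises)
and `HexBW.slabZ H n y = Ĉ_{H,n}(y,1)`).  Source: N. R. Beaton, *The critical surface fugacity of self-avoiding walks on a
rotated honeycomb lattice*, J. Phys. A 47 (2014) 075003, arXiv:1210.0274v3, §3.2 (p. 15): "Let `ĉ_{T,n}(l,m)` be the number
of `n`-step SAWs in a strip of height `T` which visit `l` vertices in the bottom surface and `m` vertices in the top …
`Ĉ_{T,n}(y,z) = Σ_{l,m} ĉ_{T,n}(l,m) y^l z^m`", Proposition 8 (p. 15): "`μ_T(y,z) = μ_T(z,y)`, and so in particular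
`μ_T(y,1) = μ_T(1,y)`" (printed by reference to BBdGDCG 2014 Proposition 6: symmetry of bridges).

## What this file adds

`rightVisits H` counts the vertices in the opposite boundary column `x₀ = H`; `slabZ₂ H n y z = Ĉ_{H,n}(y,z)` is the
two-fugacity partition function over translation classes.  The map `(x, y) ↦ (H − x, y + H)` is an automorphism of the
brick wall for EVERY `H` (`adj_slabFlip_iff`: the vertical unit is added exactly when `H` is odd, to keep the parity
classes) preserving `Slab_H` and exchanging the two boundary columns; on translation classes (re-normalised by the even
vertical shift `vnorm b − b`) it is an injection of `slabPairs H n` into itself exchanging `leftVisits` and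
`rightVisits H`.  Hence, exactly at every length:

* **`slabZ₂_symm : slabZ₂ H n y z = slabZ₂ H n z y`** (`Ĉ_{H,n}(y,z) = Ĉ_{H,n}(z,y)`);
* `slabZ₂_one_right : slabZ₂ H n y 1 = slabZ H n y`, `slabZright H n z := Ĉ_{H,n}(1,z)`,
  **`slabZright_eq_slabZ : Ĉ_{H,n}(1,y) = Ĉ_{H,n}(y,1)`** — so the statements of the armchair-slab chain about the
  left-weighted `μ_H(y,1) = HexBW.slabMuY H y` (existence, Proposition 9's strict part in
  `HexSAWBrickWallSlabFugacityStrict.lean`) are the statements about the printed other-side weight `μ_T(1,y)`.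

Label (lane «pcv-sawmu»): CONSOLIDATION of Proposition 8's symmetry clause by a different, exact finite-`n` argument
(a reflection automorphism; print: symmetry of bridges + equality of the `A`/`B`/`C` growth rates).
-/

noncomputable section

open Finset Literature.Probability.LatticeModels Literature.Probability.Percolation SimpleGraph

namespace Literature.Probability.RandomPlanarGeometry.SAW.HexBW

/-! ### The right boundary column and the two-fugacity partition function -/

/-- The number of vertices of the placed walk `m ↦ a + υ m`, `m ≤ n`, in the RIGHT boundary column `x₀ = H` of `Slab_H`
— the printed `m` of `ĉ_{T,n}(l,m)`. [cite: Beaton2014RotatedHoneycomb, §3.2, Proposition 8 (arXiv:1210.0274v3 p. 15: vertices in the top surface)] -/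
def rightVisits (H : ℕ) (a : Site 2) (υ : ℕ → Site 2) (n : ℕ) : ℕ :=
  ∑ m ∈ Finset.range (n + 1), if (a + υ m) 0 = (H : ℤ) then 1 else 0

/-- **`Ĉ_{H,n}(y,z)`** over translation classes: fugacity `y` per left-column vertex, `z` per right-column vertex.
[cite: Beaton2014RotatedHoneycomb, §3.2 (arXiv:1210.0274v3 p. 15: Ĉ_{T,n}(y,z) = Σ ĉ_{T,n}(l,m) y^l z^m)] -/
def slabZ₂ (H n : ℕ) (y z : ℝ) : ℝ :=
  ∑ p ∈ slabPairs H n, y ^ leftVisits p.1 p.2 n * z ^ rightVisits H p.1 p.2 n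

/-- **`Ĉ_{H,n}(1,z)`**: the right-weighted one-sided partition function.
[cite: Beaton2014RotatedHoneycomb, §3.2, Proposition 8 (arXiv:1210.0274v3 p. 15: μ_T(y,1) = μ_T(1,y))] -/
def slabZright (H n : ℕ) (z : ℝ) : ℝ := ∑ p ∈ slabPairs H n, z ^ rightVisits H p.1 p.2 n

/-- `Ĉ_{H,n}(y,1) = slabZ H n y`. [cite: Beaton2014RotatedHoneycomb, §3.2 (arXiv:1210.0274v3 p. 15)] -/
theorem slabZ₂_one_right (H n : ℕ) (y : ℝ) : slabZ₂ H n y 1 = slabZ H n y := by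
  simp [slabZ₂, slabZ]

/-- `Ĉ_{H,n}(1,z) = slabZright H n z`. [cite: Beaton2014RotatedHoneycomb, §3.2 (arXiv:1210.0274v3 p. 15)] -/
theorem slabZ₂_one_left (H n : ℕ) (z : ℝ) : slabZ₂ H n 1 z = slabZright H n z := by
  simp [slabZ₂, slabZright]

/-! ### The slab reflection `(x, y) ↦ (H − x, y + H)` -/

/-- The slab reflection exchanging the two boundary columns of `Slab_H`: `(x, y) ↦ (H − x, y + H)` (the vertical unit is
added exactly when `H` is odd, to keep the parity classes of the brick wall). [cite: Beaton2014RotatedHoneycomb, §3.2, Proposition 8 (arXiv:1210.0274v3 p. 15: μ_T(y,z) = μ_T(z,y))] -/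
def slabFlip (H : ℕ) (v : Site 2) : Site 2 := ![(H : ℤ) - v 0, v 1 + H]

/-- Coordinates of `slabFlip`. [cite: Beaton2014RotatedHoneycomb, §3.2, Proposition 8 (arXiv:1210.0274v3 p. 15)] -/
@[simp] theorem slabFlip_apply_zero (H : ℕ) (v : Site 2) : slabFlip H v 0 = (H : ℤ) - v 0 := rfl

/-- Coordinates of `slabFlip`. [cite: Beaton2014RotatedHoneycomb, §3.2, Proposition 8 (arXiv:1210.0274v3 p. 15)] -/
@[simp] theorem slabFlip_apply_one (H : ℕ) (v : Site 2) : slabFlip H v 1 = v 1 + H := rfl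

/-- The linear part of the slab reflection: `(x, y) ↦ (−x, y)`. [cite: EntingJensen2009, §7.4.2, Fig. 7.10 (brickwork form of the honeycomb lattice)] -/
def mirrorX (w : Site 2) : Site 2 := ![-(w 0), w 1]

/-- Coordinates of `mirrorX`. [cite: EntingJensen2009, §7.4.2, Fig. 7.10 (brickwork form of the honeycomb lattice)] -/
@[simp] theorem mirrorX_apply_zero (w : Site 2) : mirrorX w 0 = -(w 0) := rfl

/-- Coordinates of `mirrorX`. [cite: EntingJensen2009, §7.4.2, Fig. 7.10 (brickwork form of the honeycomb lattice)] -/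
@[simp] theorem mirrorX_apply_one (w : Site 2) : mirrorX w 1 = w 1 := rfl

/-- `mirrorX` is injective. [cite: EntingJensen2009, §7.4.2, Fig. 7.10 (brickwork form of the honeycomb lattice)] -/
theorem mirrorX_injective : Function.Injective mirrorX := fun v w h => by
  have h0 := congrFun h 0
  have h1 := congrFun h 1
  simp only [mirrorX_apply_zero, mirrorX_apply_one, neg_inj] at h0 h1
  funext j; fin_cases j
  · exact h0
  · exact h1

/-- `mirrorX 0 = 0`. [cite: EntingJensen2009, §7.4.2, Fig. 7.10 (brickwork form of the honeycomb lattice)] -/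
@[simp] theorem mirrorX_zero : mirrorX (0 : Site 2) = 0 := by
  funext j; fin_cases j <;> simp [mirrorX]

/-- `mirrorX` is an automorphism of `ℤ²`. [cite: EntingJensen2009, §7.4.2, Fig. 7.10 (brickwork form of the honeycomb lattice)] -/
theorem zd_adj_mirrorX_iff (x y : Site 2) : (zdGraph 2).Adj (mirrorX x) (mirrorX y) ↔ (zdGraph 2).Adj x y := by
  have hzd : ∀ x y : Site 2, (zdGraph 2).Adj x y ↔
      ((y 0 = x 0 + 1 ∨ x 0 = y 0 + 1) ∧ y 1 = x 1) ∨
        ((y 1 = x 1 + 1 ∨ x 1 = y 1 + 1) ∧ y 0 = x 0) := fun x y => by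
    rw [zdGraph_adj_iff, Fin.exists_fin_two]
    simp only [funext_iff, Fin.forall_fin_two, Pi.add_apply, Pi.single_eq_same,
      Pi.single_eq_of_ne (one_ne_zero : (1 : Fin 2) ≠ 0),
      Pi.single_eq_of_ne (zero_ne_one : (0 : Fin 2) ≠ 1), add_zero]
    omega
  rw [hzd, hzd, mirrorX_apply_zero, mirrorX_apply_zero, mirrorX_apply_one, mirrorX_apply_one]
  omega

/-- Post-composition with `mirrorX` preserves the `ℤ²` walks from `0`. [cite: MadrasSlade1993, §1.2] -/
theorem mirrorX_comp_mem_zdSaws {n : ℕ} {ω : ℕ → Site 2} (hω : ω ∈ Zd.saws 2 n) :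
    (fun i => mirrorX (ω i)) ∈ Zd.saws 2 n := by
  obtain ⟨h0, hend, hadj, hinj⟩ := Zd.mem_saws.1 hω
  refine Zd.mem_saws.2 ⟨by simp [h0], fun i hi => by simp [hend i hi], fun i hi =>
    (zd_adj_mirrorX_iff _ _).2 (hadj i hi), fun i hi j hj hij => hinj hi hj (mirrorX_injective hij)⟩

/-- `slabFlip H (a + w) = slabFlip H a + mirrorX w`. [cite: EntingJensen2009, §7.4.2, Fig. 7.10 (brickwork form of the honeycomb lattice)] -/
theorem slabFlip_add (H : ℕ) (a w : Site 2) : slabFlip H (a + w) = slabFlip H a + mirrorX w := by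
  funext j
  fin_cases j
  · simp [slabFlip, mirrorX]; ring
  · simp [slabFlip, mirrorX]; ring

/-- **The slab reflection is an automorphism of the brick wall** (for every `H`). [cite: EntingJensen2009, §7.4.2, Fig. 7.10 (brickwork form of the honeycomb lattice)] -/
theorem adj_slabFlip_iff (H : ℕ) (x y : Site 2) :
    brickWallGraph.Adj (slabFlip H x) (slabFlip H y) ↔ brickWallGraph.Adj x y := by
  simp only [brickWallGraph_adj_coord, slabFlip_apply_zero, slabFlip_apply_one]
  omega

/-- The slab reflection preserves `Slab_H`. [cite: MadrasSlade1993, §8.2, eq. (8.2.1)] -/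
theorem inSlab_slabFlip_iff (H : ℕ) (v : Site 2) : InSlab H (slabFlip H v) ↔ InSlab H v := by
  simp only [InSlab, slabFlip_apply_zero]
  omega

/-- The translation vector `vnorm b − b` is vertical and even. [cite: MadrasSlade1993, §8.2, eq. (8.2.1)] -/
theorem vnorm_sub_even (b : Site 2) : (vnorm b - b) 0 = 0 ∧ ((vnorm b - b) 0 + (vnorm b - b) 1) % 2 = 0 := by
  refine ⟨?_, ?_⟩
  · simp only [Pi.sub_apply, vnorm_apply_zero, sub_self]
  · simp only [Pi.sub_apply, vnorm_apply_zero, vnorm_apply_one, sub_self, zero_add]; omega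

/-! ### The reflection on translation classes -/

/-- The reflection on translation classes: reflect the placed walk and translate it back to the cross-section by the
even vertical vector `vnorm b − b`, `b` the reflected start. [cite: Beaton2014RotatedHoneycomb, §3.2, Proposition 8 (arXiv:1210.0274v3 p. 15: symmetry)] -/
def flipPairSlab (H : ℕ) (p : Site 2 × (ℕ → Site 2)) : Site 2 × (ℕ → Site 2) :=
  (vnorm (slabFlip H p.1), fun i => mirrorX (p.2 i))

/-- The placed image walk is an even vertical translate of the reflected placed walk. [cite: MadrasSlade1993, §8.2, eq. (8.2.1)] -/
theorem flipPairSlab_placed (H : ℕ) (p : Site 2 × (ℕ → Site 2)) (i : ℕ) :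
    (flipPairSlab H p).1 + (flipPairSlab H p).2 i =
      (vnorm (slabFlip H p.1) - slabFlip H p.1) + slabFlip H (p.1 + p.2 i) := by
  simp only [flipPairSlab, slabFlip_add]; abel

/-- **The reflection maps `slabPairs H n` into itself.** [cite: MadrasSlade1993, §8.2, eq. (8.2.1)]
[cite: Beaton2014RotatedHoneycomb, §3.2, Proposition 8 (arXiv:1210.0274v3 p. 15: symmetry)] -/
theorem flipPairSlab_mem {H n : ℕ} {p : Site 2 × (ℕ → Site 2)} (hp : p ∈ slabPairs H n) :
    flipPairSlab H p ∈ slabPairs H n := by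
  obtain ⟨ha, hυ, hbw, hin⟩ := mem_slabPairs.1 hp
  have hflip_in : InSlab H (slabFlip H p.1) := (inSlab_slabFlip_iff H p.1).2 (mem_slabStarts.1 ha).1
  obtain ⟨he0, hev⟩ := vnorm_sub_even (slabFlip H p.1)
  refine mem_slabPairs.2 ⟨vnorm_mem_slabStarts hflip_in, mirrorX_comp_mem_zdSaws hυ, fun i hi => ?_, fun m hm => ?_⟩
  · show brickWallGraph.Adj ((flipPairSlab H p).1 + (flipPairSlab H p).2 i)
      ((flipPairSlab H p).1 + (flipPairSlab H p).2 (i + 1))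
    rw [flipPairSlab_placed, flipPairSlab_placed, adj_add_left_iff_of_even hev, adj_slabFlip_iff]
    exact hbw i hi
  · show InSlab H ((flipPairSlab H p).1 + (flipPairSlab H p).2 m)
    rw [flipPairSlab_placed]
    have h := (inSlab_slabFlip_iff H (p.1 + p.2 m)).2 (hin m hm)
    refine ⟨?_, ?_⟩
    · have := h.1; simp only [Pi.add_apply, he0, zero_add]; exact this
    · have := h.2; simp only [Pi.add_apply, he0, zero_add]; exact this

/-- **The reflection is injective on `slabPairs H n`.** [cite: MadrasSlade1993, §8.2, eq. (8.2.1)] -/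
theorem flipPairSlab_injOn (H n : ℕ) : Set.InjOn (flipPairSlab H) ↑(slabPairs H n) := by
  rintro ⟨a, υ⟩ hp ⟨a', υ'⟩ hp' h
  rw [Finset.mem_coe, mem_slabPairs] at hp hp'
  dsimp only at hp hp'
  have ha := (mem_slabStarts.1 hp.1).2
  have ha' := (mem_slabStarts.1 hp'.1).2
  simp only [flipPairSlab, Prod.mk.injEq] at h
  obtain ⟨h1, h2⟩ := h
  have h1' : vnorm (slabFlip H a) 0 = vnorm (slabFlip H a') 0 ∧ vnorm (slabFlip H a) 1 = vnorm (slabFlip H a') 1 :=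
    ⟨congrFun h1 0, congrFun h1 1⟩
  simp only [vnorm_apply_zero, vnorm_apply_one, slabFlip_apply_zero, slabFlip_apply_one] at h1'
  have hυ : υ = υ' := funext fun i => mirrorX_injective (congrFun h2 i)
  have ha0 : a 0 = a' 0 := by omega
  have ha1 : a 1 = a' 1 := by omega
  have haa : a = a' := by funext j; fin_cases j <;> assumption
  rw [haa, hυ]

/-- The reflection exchanges the two boundary counts: left count of the image = right count of the walk.
[cite: Beaton2014RotatedHoneycomb, §3.2, Proposition 8 (arXiv:1210.0274v3 p. 15: symmetry)] -/
theorem leftVisits_flipPairSlab (H n : ℕ) (p : Site 2 × (ℕ → Site 2)) :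
    leftVisits (flipPairSlab H p).1 (flipPairSlab H p).2 n = rightVisits H p.1 p.2 n := by
  unfold leftVisits rightVisits
  refine Finset.sum_congr rfl fun m _ => ?_
  obtain ⟨he0, -⟩ := vnorm_sub_even (slabFlip H p.1)
  rw [flipPairSlab_placed]
  have : ((vnorm (slabFlip H p.1) - slabFlip H p.1) + slabFlip H (p.1 + p.2 m)) 0 = (H : ℤ) - (p.1 + p.2 m) 0 := by
    rw [Pi.add_apply, he0, zero_add, slabFlip_apply_zero]
  rw [this]
  by_cases h : (p.1 + p.2 m) 0 = (H : ℤ)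
  · rw [if_pos h, if_pos (by omega)]
  · rw [if_neg h, if_neg (by omega)]

/-- The reflection exchanges the two boundary counts: right count of the image = left count of the walk.
[cite: Beaton2014RotatedHoneycomb, §3.2, Proposition 8 (arXiv:1210.0274v3 p. 15: symmetry)] -/
theorem rightVisits_flipPairSlab (H n : ℕ) (p : Site 2 × (ℕ → Site 2)) :
    rightVisits H (flipPairSlab H p).1 (flipPairSlab H p).2 n = leftVisits p.1 p.2 n := by
  unfold leftVisits rightVisits
  refine Finset.sum_congr rfl fun m _ => ?_
  obtain ⟨he0, -⟩ := vnorm_sub_even (slabFlip H p.1)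
  rw [flipPairSlab_placed]
  have : ((vnorm (slabFlip H p.1) - slabFlip H p.1) + slabFlip H (p.1 + p.2 m)) 0 = (H : ℤ) - (p.1 + p.2 m) 0 := by
    rw [Pi.add_apply, he0, zero_add, slabFlip_apply_zero]
  rw [this]
  by_cases h : (p.1 + p.2 m) 0 = 0
  · rw [if_pos h, if_pos (by omega)]
  · rw [if_neg h, if_neg (by omega)]

/-! ### The symmetry -/

/-- **Proposition 8, symmetry clause, exactly at every length**: `Ĉ_{H,n}(y,z) = Ĉ_{H,n}(z,y)` over translation classes
of the armchair slab. [cite: Beaton2014RotatedHoneycomb, §3.2, Proposition 8 (arXiv:1210.0274v3 p. 15: "μ_T(y,z) = μ_T(z,y)")] -/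
theorem slabZ₂_symm (H n : ℕ) (y z : ℝ) : slabZ₂ H n y z = slabZ₂ H n z y := by
  classical
  have himg : (slabPairs H n).image (flipPairSlab H) = slabPairs H n := by
    refine Finset.eq_of_subset_of_card_le (fun q hq => ?_) ?_
    · obtain ⟨p, hp, rfl⟩ := Finset.mem_image.1 hq
      exact flipPairSlab_mem hp
    · rw [Finset.card_image_of_injOn (flipPairSlab_injOn H n)]
  calc slabZ₂ H n y z
      = ∑ p ∈ slabPairs H n, z ^ leftVisits (flipPairSlab H p).1 (flipPairSlab H p).2 n *
          y ^ rightVisits H (flipPairSlab H p).1 (flipPairSlab H p).2 n := by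
        unfold slabZ₂
        refine Finset.sum_congr rfl fun p _ => ?_
        rw [leftVisits_flipPairSlab, rightVisits_flipPairSlab, mul_comm]
    _ = ∑ q ∈ (slabPairs H n).image (flipPairSlab H), z ^ leftVisits q.1 q.2 n * y ^ rightVisits H q.1 q.2 n := by
        rw [Finset.sum_image (flipPairSlab_injOn H n)]
    _ = slabZ₂ H n z y := by rw [himg, slabZ₂]

/-- **`Ĉ_{H,n}(1,y) = Ĉ_{H,n}(y,1)`**: the right-weighted and the left-weighted one-sided partition functions of the
armchair slab coincide at every length — "in particular `μ_T(y,1) = μ_T(1,y)`".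
[cite: Beaton2014RotatedHoneycomb, §3.2, Proposition 8 (arXiv:1210.0274v3 p. 15: "and so in particular μ_T(y,1) = μ_T(1,y)")] -/
theorem slabZright_eq_slabZ (H n : ℕ) (y : ℝ) : slabZright H n y = slabZ H n y := by
  rw [← slabZ₂_one_left, slabZ₂_symm, slabZ₂_one_right]

end Literature.Probability.RandomPlanarGeometry.SAW.HexBW
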